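import Summits.QuantumFields.BalabanUV.T4Continuum.Support.NE3BlockPoincareLandau
import Summits.QuantumFields.BalabanUV.T4Continuum.Support.NE3FramePotGauge
import Summits.QuantumFields.BalabanUV.T4Continuum.Support.NE3LatticeWeitzenbock
import HarnessLib

/-!
# T⁴ programme, node NE3 — row H2 (owner ruling ρ-g21-4 (W4)(i)): THE CO-CLOSED HODGE COMPONENT `η = Y − dPot ζ` OF A k-FOLD
# FLAT TANGENT DIRECTION HAS AN EXACT STRAIGHT k-BLOCK AVERAGE, SO (71S) APPLIES TO `η` VERBATIM:
# `Σ‖η‖² ≤ 9·(L^k)²·Σ‖curl Y‖²` and `Σ_z‖(Qcoarse L)^[k] η‖² ≤ (L^k)^{4−d}·Σ‖curl Y‖²` — N-FREE, k-free (complex core + glue)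

NE3 formalisation swarm `b2b-balaban-t4-ne3-formalise-*`, LEAF PROVER 03 (unit `b2b-balaban-t4-ne3-formalise-leaf-03`, gen 7; cell
`pub-balaban`), row **H2** of the owner's ruling ρ-g21-4 (journal l.16470, (W4) «FLAT ROUTE for Φ3′ = HODGE∕LANDAU SPLIT»: `Y = η + dζ`,
`flatDiv η = 0`; (i) `Q^kη = dψ` EXACT ⇒ (71S) `lineSum_sq_le_of_exact_of_flatDiv` ∕ `sum_norm_sq_le…` apply to `η` VERBATIM»);
CLAIM journal l.16676.  H1 (the split itself, NE3-R2 g6), H3 (interpolant), H4 (frame bound), H5 (assembly) are other seats' rows: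
here `ζ` is a BINDER — any periodic 0-cochain with `flatDiv (Y − dPot ζ) ≡ 0`.

CONTENT (all [folklore]; 0 sorry; 0 `def`):
§1 COMPLEX CORE at block side `M = L^k` for a co-closed, STRAIGHT-AVERAGE-EXACT fine field: `η` `(L^k·N)`-periodic, `ψ` `N`-periodic,
   `(Qcoarse L)^[k] η = dPot ψ` (Q-EXACTNESS — NOT tangency: `η` is in general not tangent) and `Σ_κ (η x κ − η(x−e_κ) κ) = 0`:
   `lineSum_eq_of_iterate_Qcoarse_eq_dPot` (the line sums are `(M^d)•dPot ψ`), **`sum_norm_sq_iterate_Qcoarse_le_of_exact_of_flatDiv`**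
   (S-bound `Σ_z Σ_κ ‖(Qcoarse L)^[k] η z κ‖² ≤ (M^d)⁻¹·M⁴·G_diag(η)` through (71S) §2 with `μ := ψ` — `ψ` never estimated),
   **`sum_norm_sq_le_of_iterate_Qcoarse_eq_dPot_of_flatDiv`** (Poincaré `Σ‖η‖² ≤ 9·M²·G(η)` through (71S) §1, `Θ = 1`);
§2 THE FLAT CURL DOES NOT SEE `dPot ζ` (`fdCurl_sub_dPot`, matrix form `curlAt_flatCfg_sub_dPot`) and WEITZENBÖCK
   (`NE3LatticeWeitzenbock.weitzenbock_periodBox_of_div_eq_zero`): for co-closed periodic `η := Y − dPot ζ`,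
   `G(η) = Σ_x Σ_π ‖curl_π Y (x)‖²` (`sum_grad_sq_coexact_eq_curl`);
§3 THE TANGENT GLUE over Φ1 (`NE3FramePotGauge` BY NAME): `Fcoarse_sub`, `iterate_Qcoarse_sub`, `framePot_sub`, and for
   `(Tcoarse L)^[k] Y = 0`: **`iterate_Qcoarse_coexact_eq_dPot`** `(Qcoarse L)^[k] (Y − dPot ζ) = dPot (framePot L k Y − (bmean L)^[k] ζ)`
   = `dPot (framePot L k (Y − dPot ζ) − ζ∘((L^k)•·))` (`framePot_coexact`, `iterate_Qcoarse_coexact_eq_dPot'`) — the ψ-DATA of rows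
   H3∕H5 — with its `N`-periodicity (`coexactPot_add_period`);
§4 COMPLEX ENDs for a tangent `Y` and any periodic `ζ` with `Y − dPot ζ` co-closed: **`sum_norm_sq_coexact_le_curl`**
   `Σ_x Σ_κ ‖Y x κ − dPot ζ x κ‖² ≤ 9·(L^k)²·Σ_x Σ_π ‖curl_π Y(x)‖²` and **`sum_norm_sq_iterate_Qcoarse_coexact_le_curl`**
   `Σ_z Σ_κ ‖(Qcoarse L)^[k] (Y − dPot ζ) z κ‖² ≤ ((L^k)^d)⁻¹·(L^k)⁴·Σ_x Σ_π ‖curl_π Y(x)‖²` over `periodBox (L^k·N)` — N-FREE, k-free.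
(The matrix ∕ `nhsNormSq` ∕ `dirSq`–`curlSq` wrappers for `TangentIter L j flat Y` are the companion file `NE3HodgeCoexactPoincareEnd`.)

HONEST FRAMING.  Flat finite-lattice vector calculus on OUR typed objects at ONE (flat) configuration; (P♮) at `W ≠ 1`, (ML_w) at the
curved background, T-E_w and NE3 are NOT proved; nothing about Bałaban's minimisers; spine PROVED 0∕9; finite T⁴ rung (B)+1 — NOT infinite
volume, NOT mass gap, NOT BetaPertH, NOT Clay.  ABSOLUTE RULE kept (nothing printed is a hypothesis; context only:
[Balaban1985PropagatorsII] Thm 3.3 (3.46), [Balaban1985Averaging] (122)∕(125) p. 36).  PLACEMENT: `Summits/QuantumFields/BalabanUV/`;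
imports accepted modules only ((71S) `NE3BlockPoincareLandau`, Φ1 `NE3FramePotGauge`, `NE3LatticeWeitzenbock`).
-/

set_option autoImplicit false

open scoped BigOperators InnerProductSpace
open Finset

namespace Summit.QuantumFields.BalabanUV.T4Continuum.NE3HodgeCoexactPoincare

open Literature.MathematicalPhysics.QuantumFieldTheory.Balaban1983to89
open B7Prop1Explicit B7Prop3Flat
open T4AveragingDeficitWall (Plane curlAt)
open T4AveragingDeficitWallBoundary (periodBox mem_periodBox card_periodBox sum_periodBox_shift)
open MinimalActionWitness (flatCfg)
open SmoothRefineNeutral (Tcoarse asum_sub)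
open NE3TangentNoGoWords (dPot)
open NE3TangentFlatStructure (Qcoarse Fcoarse framePot framePot_succ Qcoarse_sub iterate_Tcoarse_eq_zero_iff framePot_add_period
  dPot_add_period)
open NE3FramePotGauge (bmean iterate_Qcoarse_dPot framePot_dPot)
open NE3BlockLineAverage (iterate_Qcoarse_apply)
open NE3BlockPoincareLandau (sum_norm_sq_le_of_lineSum_sq_le lineSum_sq_le_of_exact_of_flatDiv)
open NE3LatticeWeitzenbock (weitzenbock_periodBox_of_div_eq_zero curlAt_flatCfg)

noncomputable section

variable {d : ℕ}

/-! ## §1 Complex core: a co-closed fine field with an EXACT straight k-block average -/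

/-- If the straight k-fold average of `η` is exact, `(Qcoarse L)^[k] η = dPot ψ`, its unnormalised line sums are
`Σ_v Σ_{i<L^k} η(L^k•z + v + i e_κ) κ = ((L^k)^d) • dPot ψ z κ` (leaf-04's tiling `iterate_Qcoarse_apply`). [folklore] -/
theorem lineSum_eq_of_iterate_Qcoarse_eq_dPot {L : ℕ} (hL : 1 ≤ L) (k : ℕ) (η : Site d → Fin d → ℂ) (ψ : Site d → ℂ)
    (hQ : (Qcoarse L)^[k] η = dPot ψ) (z : Site d) (κ : Fin d) :
    ∑ v ∈ periodBox (d := d) (L ^ k), ∑ i ∈ range (L ^ k), η (((L ^ k : ℕ) : ℤ) • z + v + (i : ℤ) • e κ) κ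
      = ((((L ^ k : ℕ) : ℝ)) ^ d) • dPot ψ z κ := by
  have hMd : (0 : ℝ) < (((L ^ k : ℕ) : ℝ)) ^ d := by
    have : (0 : ℝ) < ((L ^ k : ℕ) : ℝ) := by exact_mod_cast Nat.pos_of_ne_zero (by positivity)
    positivity
  have h := iterate_Qcoarse_apply hL k η z κ
  rw [hQ] at h
  rw [h, smul_smul, mul_inv_cancel₀ (ne_of_gt hMd), one_smul]

/-- **THE N-FREE S-BOUND FOR A CO-CLOSED, STRAIGHT-AVERAGE-EXACT FIELD** (`Qcoarse` currency, complex values): `L, N ≥ 1`, `η`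
`(L^k·N)`-periodic, `ψ` `N`-periodic, `(Qcoarse L)^[k] η = dPot ψ`, `Σ_κ (η x κ − η (x − e_κ) κ) = 0` ⇒
`Σ_{z∈periodBox N} Σ_κ ‖(Qcoarse L)^[k] η z κ‖² ≤ ((L^k)^d)⁻¹·(L^k)⁴·Σ_x Σ_κ ‖η x κ − η (x − e_κ) κ‖²` — (71S) §2 with `μ := ψ`
(`ψ` is never estimated).  Tangency of `η` is NOT assumed. [folklore] -/
theorem sum_norm_sq_iterate_Qcoarse_le_of_exact_of_flatDiv {L : ℕ} (hL : 1 ≤ L) {N : ℕ} (hN : 1 ≤ N) (k : ℕ)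
    (η : Site d → Fin d → ℂ) (ψ : Site d → ℂ)
    (hη : ∀ (x : Site d) (τ μ : Fin d), η (x + ((L ^ k * N : ℕ) : ℤ) • e τ) μ = η x μ)
    (hψ : ∀ (z : Site d) (τ : Fin d), ψ (z + (N : ℤ) • e τ) = ψ z)
    (hQ : (Qcoarse L)^[k] η = dPot ψ) (hdiv : ∀ x : Site d, ∑ κ : Fin d, (η x κ - η (x - e κ) κ) = 0) :
    ∑ z ∈ periodBox (d := d) N, ∑ κ : Fin d, ‖(Qcoarse L)^[k] η z κ‖ ^ 2
      ≤ ((((L ^ k : ℕ) : ℝ)) ^ d)⁻¹ * (((L ^ k : ℕ) : ℝ)) ^ 4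
          * ∑ x ∈ periodBox (d := d) (L ^ k * N), ∑ κ : Fin d, ‖η x κ - η (x - e κ) κ‖ ^ 2 := by
  have hex := lineSum_eq_of_iterate_Qcoarse_eq_dPot hL k η ψ hQ
  have htil : ∀ (z : Site d) (κ : Fin d), (Qcoarse L)^[k] η z κ = (((((L ^ k : ℕ) : ℝ)) ^ d)⁻¹ : ℝ) •
      ∑ v ∈ periodBox (d := d) (L ^ k), ∑ i ∈ range (L ^ k), η (((L ^ k : ℕ) : ℤ) • z + v + (i : ℤ) • e κ) κ :=
    fun z κ => iterate_Qcoarse_apply hL k η z κ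
  set M : ℕ := L ^ k with hMdef
  have hM : 1 ≤ M := Nat.one_le_pow _ _ hL
  have hMd : (0 : ℝ) < (M : ℝ) ^ d := by positivity
  have hS := lineSum_sq_le_of_exact_of_flatDiv hM hN ψ η hψ hη hex hdiv
  calc ∑ z ∈ periodBox (d := d) N, ∑ κ : Fin d, ‖(Qcoarse L)^[k] η z κ‖ ^ 2
      = (((M : ℝ) ^ d)⁻¹) ^ 2 * ∑ z ∈ periodBox (d := d) N, ∑ κ : Fin d,
          ‖∑ v ∈ periodBox (d := d) M, ∑ i ∈ range M, η ((M : ℤ) • z + v + (i : ℤ) • e κ) κ‖ ^ 2 := by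
        rw [Finset.mul_sum]
        refine Finset.sum_congr rfl fun z _ => ?_
        rw [Finset.mul_sum]
        refine Finset.sum_congr rfl fun κ _ => ?_
        rw [htil, norm_smul, Real.norm_of_nonneg (by positivity), mul_pow]
    _ ≤ (((M : ℝ) ^ d)⁻¹) ^ 2 * ((M : ℝ) ^ (d + 4) * ∑ x ∈ periodBox (d := d) (M * N), ∑ κ : Fin d, ‖η x κ - η (x - e κ) κ‖ ^ 2) :=
        mul_le_mul_of_nonneg_left hS (by positivity)
    _ = ((M : ℝ) ^ d)⁻¹ * (M : ℝ) ^ 4 * ∑ x ∈ periodBox (d := d) (M * N), ∑ κ : Fin d, ‖η x κ - η (x - e κ) κ‖ ^ 2 := by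
        field_simp; ring

/-- The diagonal (longitudinal) gradient energy of a periodic field is at most its full gradient energy. [folklore] -/
theorem sum_diag_grad_sq_le {P : ℕ} (hP : 1 ≤ P) (η : Site d → Fin d → ℂ)
    (hη : ∀ (x : Site d) (τ μ : Fin d), η (x + (P : ℤ) • e τ) μ = η x μ) :
    ∑ x ∈ periodBox (d := d) P, ∑ κ : Fin d, ‖η x κ - η (x - e κ) κ‖ ^ 2
      ≤ ∑ x ∈ periodBox (d := d) P, ∑ κ : Fin d, ∑ μ : Fin d, ‖η (x + e μ) κ - η x κ‖ ^ 2 := by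
  calc ∑ x ∈ periodBox (d := d) P, ∑ κ : Fin d, ‖η x κ - η (x - e κ) κ‖ ^ 2
      = ∑ κ : Fin d, ∑ x ∈ periodBox (d := d) P, ‖η x κ - η (x - e κ) κ‖ ^ 2 := Finset.sum_comm
    _ = ∑ κ : Fin d, ∑ x ∈ periodBox (d := d) P, ‖η (x + e κ) κ - η x κ‖ ^ 2 := by
        refine Finset.sum_congr rfl fun κ _ => ?_
        have hper : ∀ (x : Site d) (τ : Fin d),
            ‖η (x + (P : ℤ) • e τ + e κ) κ - η (x + (P : ℤ) • e τ) κ‖ ^ 2 = ‖η (x + e κ) κ - η x κ‖ ^ 2 := by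
          intro x τ; rw [add_right_comm, hη, hη]
        rw [← sum_periodBox_shift P hP (g := fun x => ‖η (x + e κ) κ - η x κ‖ ^ 2) hper (-e κ)]
        refine Finset.sum_congr rfl fun x _ => ?_
        simp only [← sub_eq_add_neg, sub_add_cancel]
    _ ≤ ∑ κ : Fin d, ∑ x ∈ periodBox (d := d) P, ∑ μ : Fin d, ‖η (x + e μ) κ - η x κ‖ ^ 2 :=
        Finset.sum_le_sum fun κ _ => Finset.sum_le_sum fun x _ =>
          Finset.single_le_sum (f := fun μ => ‖η (x + e μ) κ - η x κ‖ ^ 2) (fun _ _ => sq_nonneg _) (Finset.mem_univ κ)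
    _ = ∑ x ∈ periodBox (d := d) P, ∑ κ : Fin d, ∑ μ : Fin d, ‖η (x + e μ) κ - η x κ‖ ^ 2 := Finset.sum_comm

/-- **N-FREE BLOCK-POINCARÉ FOR A CO-CLOSED, STRAIGHT-AVERAGE-EXACT FIELD** (complex values): `L, N ≥ 1`, `η` `(L^k·N)`-periodic,
`ψ` `N`-periodic, `(Qcoarse L)^[k] η = dPot ψ` and `Σ_κ (η x κ − η (x − e_κ) κ) = 0` ⇒
`Σ_x Σ_κ ‖η x κ‖² ≤ 9·(L^k)²·Σ_x Σ_κ Σ_μ ‖η(x+e_μ) κ − η x κ‖²` over `periodBox (L^k·N)` — (71S) §1 (`Θ = 1`) on the exact line sums;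
k-free, L-free, N-free.  (71S) §3 is the special case `ψ = framePot L k η` of a TANGENT `η`. [folklore] -/
theorem sum_norm_sq_le_of_iterate_Qcoarse_eq_dPot_of_flatDiv {L : ℕ} (hL : 1 ≤ L) {N : ℕ} (hN : 1 ≤ N) (k : ℕ)
    (η : Site d → Fin d → ℂ) (ψ : Site d → ℂ)
    (hη : ∀ (x : Site d) (τ μ : Fin d), η (x + ((L ^ k * N : ℕ) : ℤ) • e τ) μ = η x μ)
    (hψ : ∀ (z : Site d) (τ : Fin d), ψ (z + (N : ℤ) • e τ) = ψ z)
    (hQ : (Qcoarse L)^[k] η = dPot ψ) (hdiv : ∀ x : Site d, ∑ κ : Fin d, (η x κ - η (x - e κ) κ) = 0) :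
    ∑ x ∈ periodBox (d := d) (L ^ k * N), ∑ κ : Fin d, ‖η x κ‖ ^ 2
      ≤ 9 * ((L : ℝ) ^ k) ^ 2 * ∑ x ∈ periodBox (d := d) (L ^ k * N), ∑ κ : Fin d, ∑ μ : Fin d, ‖η (x + e μ) κ - η x κ‖ ^ 2 := by
  have hex := lineSum_eq_of_iterate_Qcoarse_eq_dPot hL k η ψ hQ
  set M : ℕ := L ^ k with hMdef
  have hM : 1 ≤ M := Nat.one_le_pow _ _ hL
  have hMN : 1 ≤ M * N := Nat.one_le_iff_ne_zero.mpr (Nat.mul_ne_zero (by omega) (by omega))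
  have hMR : ((L : ℝ) ^ k) = (M : ℝ) := by rw [hMdef]; push_cast; ring
  have hS := lineSum_sq_le_of_exact_of_flatDiv hM hN ψ η hψ hη hex hdiv
  have hdiagle := sum_diag_grad_sq_le hMN η hη
  have hT1 : ∑ z ∈ periodBox (d := d) N, ∑ κ : Fin d,
      ‖∑ v ∈ periodBox (d := d) M, ∑ i ∈ range M, η ((M : ℤ) • z + v + (i : ℤ) • e κ) κ‖ ^ 2
        ≤ 1 * ((M : ℝ) ^ d * (M : ℝ) ^ 4)
          * ∑ x ∈ periodBox (d := d) (M * N), ∑ κ : Fin d, ∑ μ : Fin d, ‖η (x + e μ) κ - η x κ‖ ^ 2 := by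
    refine hS.trans ?_
    rw [one_mul, pow_add]
    exact mul_le_mul_of_nonneg_left hdiagle (by positivity)
  have h := sum_norm_sq_le_of_lineSum_sq_le hM hN η hη hT1
  rw [hMR]
  calc ∑ x ∈ periodBox (d := d) (M * N), ∑ κ : Fin d, ‖η x κ‖ ^ 2
      ≤ (5 + 4 * 1) * (M : ℝ) ^ 2 * ∑ x ∈ periodBox (d := d) (M * N), ∑ κ : Fin d, ∑ μ : Fin d, ‖η (x + e μ) κ - η x κ‖ ^ 2 := h
    _ = 9 * (M : ℝ) ^ 2 * ∑ x ∈ periodBox (d := d) (M * N), ∑ κ : Fin d, ∑ μ : Fin d, ‖η (x + e μ) κ - η x κ‖ ^ 2 := by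
        norm_num

/-! ## §2 The flat curl does not see `dPot ζ`; Weitzenböck for the co-closed component -/

section Curl

variable {𝔸 : Type*} [NormedRing 𝔸]

/-- **THE FLAT LATTICE CURL OF AN EXACT COCHAIN VANISHES**, in the difference form used by `NE3LatticeWeitzenbock`:
`∂_μ(Y − dζ)_ν − ∂_ν(Y − dζ)_μ = ∂_μY_ν − ∂_νY_μ`. [folklore] -/
theorem fdCurl_sub_dPot (Y : Site d → Fin d → 𝔸) (ζ : Site d → 𝔸) (x : Site d) (μ ν : Fin d) :
    ((Y (x + e μ) ν - dPot ζ (x + e μ) ν) - (Y x ν - dPot ζ x ν))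
        - ((Y (x + e ν) μ - dPot ζ (x + e ν) μ) - (Y x μ - dPot ζ x μ))
      = (Y (x + e μ) ν - Y x ν) - (Y (x + e ν) μ - Y x μ) := by
  have hc : x + e ν + e μ = x + e μ + e ν := add_right_comm _ _ _
  simp only [dPot, hc]
  abel

/-- A co-closed-type difference `Y − dPot ζ` of periodic data is periodic. [folklore] -/
theorem coexact_add_period {Y : Site d → Fin d → 𝔸} {ζ : Site d → 𝔸} {P : ℤ}
    (hY : ∀ (x : Site d) (τ μ : Fin d), Y (x + P • e τ) μ = Y x μ) (hζ : ∀ (x : Site d) (τ : Fin d), ζ (x + P • e τ) = ζ x)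
    (x : Site d) (τ μ : Fin d) : Y (x + P • e τ) μ - dPot ζ (x + P • e τ) μ = Y x μ - dPot ζ x μ := by
  rw [hY, dPot_add_period hζ]

end Curl

/-- **WEITZENBÖCK FOR THE CO-CLOSED COMPONENT** (complex values): for `P`-periodic `Y`, `ζ` with `η := Y − dPot ζ` co-closed
(`Σ_μ (η x μ − η (x − e_μ) μ) = 0`), the gradient energy of `η` IS the curl energy of `Y`:
`Σ_x Σ_κ Σ_μ ‖η(x+e_μ) κ − η x κ‖² = Σ_x Σ_{π} ‖∂_{π₁}Y_{π₂} − ∂_{π₂}Y_{π₁}‖²` over one period. [folklore] -/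
theorem sum_grad_sq_coexact_eq_curl {P : ℕ} (hP : 1 ≤ P) (Y : Site d → Fin d → ℂ) (ζ : Site d → ℂ)
    (hY : ∀ (x : Site d) (τ μ : Fin d), Y (x + (P : ℤ) • e τ) μ = Y x μ) (hζ : ∀ (x : Site d) (τ : Fin d), ζ (x + (P : ℤ) • e τ) = ζ x)
    (hdiv : ∀ x : Site d, ∑ μ : Fin d, ((Y x μ - dPot ζ x μ) - (Y (x - e μ) μ - dPot ζ (x - e μ) μ)) = 0) :
    ∑ x ∈ periodBox (d := d) P, ∑ κ : Fin d, ∑ μ : Fin d,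
        ‖(Y (x + e μ) κ - dPot ζ (x + e μ) κ) - (Y x κ - dPot ζ x κ)‖ ^ 2
      = ∑ x ∈ periodBox (d := d) P, ∑ π : Plane d,
          ‖(Y (x + e π.1.1) π.1.2 - Y x π.1.2) - (Y (x + e π.1.2) π.1.1 - Y x π.1.1)‖ ^ 2 := by
  have hη : ∀ (x : Site d) (τ μ : Fin d),
      (fun y ν => Y y ν - dPot ζ y ν) (x + (P : ℤ) • e τ) μ = (fun y ν => Y y ν - dPot ζ y ν) x μ :=
    fun x τ μ => coexact_add_period hY hζ x τ μ
  have hW := weitzenbock_periodBox_of_div_eq_zero (E := ℂ) hP (Y := fun y ν => Y y ν - dPot ζ y ν) hη hdiv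
  simp only [fdCurl_sub_dPot] at hW
  rw [← hW]
  exact Finset.sum_congr rfl fun x _ => Finset.sum_comm

/-! ## §3 The tangent glue: on `ker (Tcoarse L)^[k]` the co-closed component has an exact straight average -/

section Glue

variable {𝔸 : Type*} [NormedRing 𝔸] [NormedAlgebra ℂ 𝔸]

/-- `Fcoarse` is additive: subtraction. [folklore] -/
theorem Fcoarse_sub (L : ℕ) (A B : Site d → Fin d → 𝔸) (w : Site d) :
    Fcoarse L (fun y μ => A y μ - B y μ) w = Fcoarse L A w - Fcoarse L B w := by
  simp only [Fcoarse, Fhat, asum_sub, smul_sub, Finset.sum_sub_distrib]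

/-- The iterated straight average is additive: subtraction (as cochains). [folklore] -/
theorem iterate_Qcoarse_sub (L : ℕ) : ∀ (j : ℕ) (A B : Site d → Fin d → 𝔸),
    (Qcoarse L)^[j] (fun y μ => A y μ - B y μ) = fun z κ => (Qcoarse L)^[j] A z κ - (Qcoarse L)^[j] B z κ
  | 0, _, _ => rfl
  | j + 1, A, B => by
      have h1 : Qcoarse L (fun y μ => A y μ - B y μ) = fun z κ => Qcoarse L A z κ - Qcoarse L B z κ :=
        funext fun z => funext fun κ => Qcoarse_sub L A B z κ
      rw [Function.iterate_succ_apply, h1, iterate_Qcoarse_sub L j]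
      rfl

/-- The frame potential is additive: subtraction. [folklore] -/
theorem framePot_sub (L : ℕ) : ∀ (k : ℕ) (A B : Site d → Fin d → 𝔸) (z : Site d),
    framePot L k (fun y μ => A y μ - B y μ) z = framePot L k A z - framePot L k B z
  | 0, _, _, _ => by simp
  | k + 1, A, B, z => by
      rw [framePot_succ, framePot_succ, framePot_succ, iterate_Qcoarse_sub, Fcoarse_sub, framePot_sub L k]
      abel

omit [NormedAlgebra ℂ 𝔸] in
/-- The coboundary is additive: subtraction of potentials. [folklore] -/
theorem dPot_sub (Φ Ψ : Site d → 𝔸) (z : Site d) (κ : Fin d) :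
    dPot (fun w => Φ w - Ψ w) z κ = dPot Φ z κ - dPot Ψ z κ := by
  simp only [dPot]; abel

/-- **THE FRAME POTENTIAL OF THE CO-CLOSED COMPONENT**: `framePot L k (Y − dPot ζ) z = framePot L k Y z − ((bmean L)^[k] ζ z − ζ((L^k)•z))`
(Φ1's `framePot_dPot` BY NAME). [folklore] -/
theorem framePot_coexact {L : ℕ} (hL : 1 ≤ L) (k : ℕ) (Y : Site d → Fin d → 𝔸) (ζ : Site d → 𝔸) (z : Site d) :
    framePot L k (fun y μ => Y y μ - dPot ζ y μ) z = framePot L k Y z - ((bmean L)^[k] ζ z - ζ (((L : ℤ) ^ k) • z)) := by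
  rw [framePot_sub, framePot_dPot hL]

/-- **ON THE k-FOLD FLAT TANGENT SPACE THE CO-CLOSED COMPONENT HAS AN EXACT STRAIGHT k-BLOCK AVERAGE** (first spelling):
`(Tcoarse L)^[k] Y = 0 ⟹ (Qcoarse L)^[k] (Y − dPot ζ) = dPot (framePot L k Y − (bmean L)^[k] ζ)` — the frames are coarse-exact
(`iterate_Tcoarse_eq_zero_iff`) and the straight average of a coboundary is the coboundary of the block mean (`iterate_Qcoarse_dPot`).
No hypothesis on `ζ`. [folklore] -/
theorem iterate_Qcoarse_coexact_eq_dPot {L : ℕ} (hL : 1 ≤ L) (k : ℕ) (Y : Site d → Fin d → 𝔸) (ζ : Site d → 𝔸)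
    (hT : (Tcoarse L)^[k] Y = 0) :
    (Qcoarse L)^[k] (fun y μ => Y y μ - dPot ζ y μ) = dPot (fun z => framePot L k Y z - (bmean L)^[k] ζ z) := by
  have hQY : (Qcoarse L)^[k] Y = dPot (framePot L k Y) := (iterate_Tcoarse_eq_zero_iff hL k Y).mp hT
  rw [iterate_Qcoarse_sub, hQY, iterate_Qcoarse_dPot]
  funext z κ
  rw [dPot_sub]

/-- **THE SAME, SECOND SPELLING (the ψ-data of rows H3∕H5)**: `(Tcoarse L)^[k] Y = 0 ⟹
(Qcoarse L)^[k] (Y − dPot ζ) = dPot (framePot L k (Y − dPot ζ) − ζ∘((L^k)•·))` — the corner values of `ζ` are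
`framePot L k η − ψ`. [folklore] -/
theorem iterate_Qcoarse_coexact_eq_dPot' {L : ℕ} (hL : 1 ≤ L) (k : ℕ) (Y : Site d → Fin d → 𝔸) (ζ : Site d → 𝔸)
    (hT : (Tcoarse L)^[k] Y = 0) :
    (Qcoarse L)^[k] (fun y μ => Y y μ - dPot ζ y μ)
      = dPot (fun z => framePot L k (fun y μ => Y y μ - dPot ζ y μ) z - ζ (((L : ℤ) ^ k) • z)) := by
  rw [iterate_Qcoarse_coexact_eq_dPot hL k Y ζ hT]
  congr 1
  funext z
  rw [framePot_coexact hL]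
  abel

/-- PERIODICITY OF THE ψ-DATA: for `(L^k·P)`-periodic `Y`, `ζ`, the potential `framePot L k (Y − dPot ζ) − ζ∘((L^k)•·)` is
`P`-periodic. [folklore] -/
theorem coexactPot_add_period (L : ℕ) (k : ℕ) {Y : Site d → Fin d → 𝔸} {ζ : Site d → 𝔸} {P : ℤ}
    (hY : ∀ (x : Site d) (τ μ : Fin d), Y (x + ((L : ℤ) ^ k * P) • e τ) μ = Y x μ)
    (hζ : ∀ (x : Site d) (τ : Fin d), ζ (x + ((L : ℤ) ^ k * P) • e τ) = ζ x) (z : Site d) (τ : Fin d) :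
    framePot L k (fun y μ => Y y μ - dPot ζ y μ) (z + P • e τ) - ζ (((L : ℤ) ^ k) • (z + P • e τ))
      = framePot L k (fun y μ => Y y μ - dPot ζ y μ) z - ζ (((L : ℤ) ^ k) • z) := by
  have hη : ∀ (x : Site d) (τ' μ : Fin d),
      (fun y ν => Y y ν - dPot ζ y ν) (x + ((L : ℤ) ^ k * P) • e τ') μ = (fun y ν => Y y ν - dPot ζ y ν) x μ :=
    fun x τ' μ => coexact_add_period hY hζ x τ' μ
  rw [framePot_add_period L k _ hη z τ, smul_add, smul_smul, hζ]

end Glue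

/-! ## §4 Complex ENDs on the k-fold flat tangent space: Poincaré and S-bound of the co-closed component against `curl Y` -/

/-- **N-FREE BLOCK-POINCARÉ OF THE CO-CLOSED COMPONENT AGAINST THE CURL** (complex values): `L, N ≥ 1`, `Y` and `ζ`
`(L^k·N)`-periodic, `(Tcoarse L)^[k] Y = 0` (k-fold tangent at the flat background) and `η := Y − dPot ζ` co-closed
(`Σ_μ (η x μ − η(x−e_μ) μ) = 0`).  Then
`Σ_x Σ_κ ‖Y x κ − dPot ζ x κ‖² ≤ 9·(L^k)²·Σ_x Σ_π ‖∂_{π₁}Y_{π₂}(x) − ∂_{π₂}Y_{π₁}(x)‖²` over `periodBox (L^k·N)` — k-free, L-free, N-FREE;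
`ζ`, `ψ` never estimated. [folklore] -/
theorem sum_norm_sq_coexact_le_curl {L : ℕ} (hL : 1 ≤ L) {N : ℕ} (hN : 1 ≤ N) (k : ℕ)
    (Y : Site d → Fin d → ℂ) (ζ : Site d → ℂ)
    (hY : ∀ (x : Site d) (τ μ : Fin d), Y (x + ((L ^ k * N : ℕ) : ℤ) • e τ) μ = Y x μ)
    (hζ : ∀ (x : Site d) (τ : Fin d), ζ (x + ((L ^ k * N : ℕ) : ℤ) • e τ) = ζ x)
    (hT : (Tcoarse L)^[k] Y = 0)
    (hdiv : ∀ x : Site d, ∑ μ : Fin d, ((Y x μ - dPot ζ x μ) - (Y (x - e μ) μ - dPot ζ (x - e μ) μ)) = 0) :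
    ∑ x ∈ periodBox (d := d) (L ^ k * N), ∑ κ : Fin d, ‖Y x κ - dPot ζ x κ‖ ^ 2
      ≤ 9 * ((L : ℝ) ^ k) ^ 2 * ∑ x ∈ periodBox (d := d) (L ^ k * N), ∑ π : Plane d,
          ‖(Y (x + e π.1.1) π.1.2 - Y x π.1.2) - (Y (x + e π.1.2) π.1.1 - Y x π.1.1)‖ ^ 2 := by
  have hMN : 1 ≤ L ^ k * N := Nat.one_le_iff_ne_zero.mpr (Nat.mul_ne_zero (by positivity) (by omega))
  have hY' : ∀ (x : Site d) (τ μ : Fin d), Y (x + ((L : ℤ) ^ k * N) • e τ) μ = Y x μ := by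
    intro x τ μ; have := hY x τ μ; push_cast at this; exact this
  have hζ' : ∀ (x : Site d) (τ : Fin d), ζ (x + ((L : ℤ) ^ k * N) • e τ) = ζ x := by
    intro x τ; have := hζ x τ; push_cast at this; exact this
  have hη : ∀ (x : Site d) (τ μ : Fin d),
      (fun y ν => Y y ν - dPot ζ y ν) (x + ((L ^ k * N : ℕ) : ℤ) • e τ) μ = (fun y ν => Y y ν - dPot ζ y ν) x μ :=
    fun x τ μ => coexact_add_period hY hζ x τ μ
  have hψ : ∀ (z : Site d) (τ : Fin d),
      (fun w => framePot L k (fun y μ => Y y μ - dPot ζ y μ) w - ζ (((L : ℤ) ^ k) • w)) (z + (N : ℤ) • e τ)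
        = (fun w => framePot L k (fun y μ => Y y μ - dPot ζ y μ) w - ζ (((L : ℤ) ^ k) • w)) z :=
    fun z τ => coexactPot_add_period L k hY' hζ' z τ
  have hQ := iterate_Qcoarse_coexact_eq_dPot' hL k Y ζ hT
  have h := sum_norm_sq_le_of_iterate_Qcoarse_eq_dPot_of_flatDiv hL hN k (fun y ν => Y y ν - dPot ζ y ν) _ hη hψ hQ hdiv
  rw [sum_grad_sq_coexact_eq_curl hMN Y ζ hY hζ hdiv] at h
  exact h

/-- **N-FREE S-BOUND OF THE CO-CLOSED COMPONENT AGAINST THE CURL** (complex values, `Qcoarse` currency): under the same hypotheses,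
`Σ_{z∈periodBox N} Σ_κ ‖(Qcoarse L)^[k] (Y − dPot ζ) z κ‖² ≤ ((L^k)^d)⁻¹·(L^k)⁴·Σ_x Σ_π ‖∂_{π₁}Y_{π₂}(x) − ∂_{π₂}Y_{π₁}(x)‖²`
(= `(L^k)^{4−d}·curl²`; constant ONE) — the `Σ|dψ|²` input of the interpolant cost of row H5. [folklore] -/
theorem sum_norm_sq_iterate_Qcoarse_coexact_le_curl {L : ℕ} (hL : 1 ≤ L) {N : ℕ} (hN : 1 ≤ N) (k : ℕ)
    (Y : Site d → Fin d → ℂ) (ζ : Site d → ℂ)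
    (hY : ∀ (x : Site d) (τ μ : Fin d), Y (x + ((L ^ k * N : ℕ) : ℤ) • e τ) μ = Y x μ)
    (hζ : ∀ (x : Site d) (τ : Fin d), ζ (x + ((L ^ k * N : ℕ) : ℤ) • e τ) = ζ x)
    (hT : (Tcoarse L)^[k] Y = 0)
    (hdiv : ∀ x : Site d, ∑ μ : Fin d, ((Y x μ - dPot ζ x μ) - (Y (x - e μ) μ - dPot ζ (x - e μ) μ)) = 0) :
    ∑ z ∈ periodBox (d := d) N, ∑ κ : Fin d, ‖(Qcoarse L)^[k] (fun y μ => Y y μ - dPot ζ y μ) z κ‖ ^ 2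
      ≤ ((((L ^ k : ℕ) : ℝ)) ^ d)⁻¹ * (((L ^ k : ℕ) : ℝ)) ^ 4
          * ∑ x ∈ periodBox (d := d) (L ^ k * N), ∑ π : Plane d,
              ‖(Y (x + e π.1.1) π.1.2 - Y x π.1.2) - (Y (x + e π.1.2) π.1.1 - Y x π.1.1)‖ ^ 2 := by
  have hMN : 1 ≤ L ^ k * N := Nat.one_le_iff_ne_zero.mpr (Nat.mul_ne_zero (by positivity) (by omega))
  have hY' : ∀ (x : Site d) (τ μ : Fin d), Y (x + ((L : ℤ) ^ k * N) • e τ) μ = Y x μ := by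
    intro x τ μ; have := hY x τ μ; push_cast at this; exact this
  have hζ' : ∀ (x : Site d) (τ : Fin d), ζ (x + ((L : ℤ) ^ k * N) • e τ) = ζ x := by
    intro x τ; have := hζ x τ; push_cast at this; exact this
  have hη : ∀ (x : Site d) (τ μ : Fin d),
      (fun y ν => Y y ν - dPot ζ y ν) (x + ((L ^ k * N : ℕ) : ℤ) • e τ) μ = (fun y ν => Y y ν - dPot ζ y ν) x μ :=
    fun x τ μ => coexact_add_period hY hζ x τ μ
  have hψ : ∀ (z : Site d) (τ : Fin d),
      (fun w => framePot L k (fun y μ => Y y μ - dPot ζ y μ) w - ζ (((L : ℤ) ^ k) • w)) (z + (N : ℤ) • e τ)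
        = (fun w => framePot L k (fun y μ => Y y μ - dPot ζ y μ) w - ζ (((L : ℤ) ^ k) • w)) z :=
    fun z τ => coexactPot_add_period L k hY' hζ' z τ
  have hQ := iterate_Qcoarse_coexact_eq_dPot' hL k Y ζ hT
  have h := sum_norm_sq_iterate_Qcoarse_le_of_exact_of_flatDiv hL hN k (fun y ν => Y y ν - dPot ζ y ν) _ hη hψ hQ hdiv
  have hdiag := sum_diag_grad_sq_le hMN (fun y ν => Y y ν - dPot ζ y ν) hη
  rw [sum_grad_sq_coexact_eq_curl hMN Y ζ hY hζ hdiv] at hdiag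
  exact h.trans (mul_le_mul_of_nonneg_left hdiag (by positivity))

end

end Summit.QuantumFields.BalabanUV.T4Continuum.NE3HodgeCoexactPoincare
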